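import Summits.RiemannHypothesis.RiemannHypothesis.Theorems.MotivicDoorFfSparseWalk

/-!
# Motivic door, function-field side (C)(i), part 7b: SPARSE LAG SETS — the exact threshold below the handover
(pub-rhdoor seat ff-1.  HONEST FRAMING: lottery ticket at the motivic door; RH probability negligible; consolation
prizes are real: a new semi-local Weil-positivity theorem, or a located gap in the Connes–Consani programme, plus the
ff-door theorem.  No claim about `ζ`; "RH(q,h)" is `|α| = √q` for the complex roots of ONE integer polynomial `h`.)

Continuation of part 7a (`MotivicDoorFfSparseWalk`: through every honest datum of dimension `g` and off every lag
`m ∈ [1, g]` the sparse fibre `{f honest : s_j(f) = s_j(h), j ∈ [1,g] ∖ {m}}` is infinite with finite RH-true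
part).  A reader `Φ : Tower → Prop` is `F`-TRACE-LOCAL (`F : Set ℕ`, inline hypothesis `hloc`) if it only depends on
the corner entries `T_n(0,n) = K(n)`, `n ∈ F` — on the point counts `N_n`, `n ∈ F`.  PROVED here, [folklore]:

* §4 MATCHED BY HONEST FAKES: a trace reader reading only lags in `[0, g] ∖ {m}` (`1 ≤ m ≤ g`, `q ≥ 1`) that accepts
  ONE honest datum of dimension `g` accepts INFINITELY MANY honest RH-false data of dimension `g` with the very same
  traces (`traceReader_offLag_fakes_infinite`, `traceReader_offLag_matched_by_rhFalse` — the `∃`-form matching part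
  2's `finiteWindow_matched_by_rhFalse`).  POSITION DOES NOT RESCUE A SPARSE READER BELOW THE HANDOVER.
* §5 EXACT THRESHOLD (`traceReader_decides_iff`): for `q, g ≥ 1` and a lag set `F ⊆ [0, g]`, an `F`-trace-local
  reader deciding RH on the honest data of dimension `g` EXISTS IF AND ONLY IF `F ⊇ {1, …, g}` (⇐: the traces
  `K(1), …, K(g)` PIN the datum — Newton `s ↦ e`, Vieta, FE; `eq_of_powerSum_eq_upto`, `exists_traceReader_deciding`,
  the trace form of ffmirror-2's Handover `exists_windowReader_of_predicate`; ⇒: §4 against the RH-true datum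
  `x^{2g} + q^g`).  Count form: fewer than `g` positive lags `≤ g` never decide (`traceReader_not_decides_of_card_lt`).

DOOR READING ((i).G below the handover, quantifiers in final position): among sub-readings of the first `g` traces
(point counts `N_1, …, N_g`) ONLY THE FULL SET certifies RH at dimension `g`, and it does so by pinning the datum —
never a sparse or cleverly placed sub-reading, whatever `q`.  Lags beyond `g`: part 7c.  Nothing here is, or implies,
a statement about `ζ`.
-/

set_option linter.dupNamespace false

noncomputable section

open Polynomial Finset

open Summit.RiemannHypothesis.RiemannHypothesis.Theorems.PfPersistence.FfAngleTwin

namespace Summit.RiemannHypothesis.RiemannHypothesis.Theorems.MotivicDoor.FunctionField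

/-! ## 4. Door reading below the handover: trace readers off one lag are matched by honest fakes

A reader `Φ : Tower → Prop` is `F`-TRACE-LOCAL if it depends only on the corner entries `T_n(0,n) = K(n)`, `n ∈ F`
(inline hypothesis `hloc`; `F : Set ℕ` may be infinite).  Examples: any function of the point counts
`N_n = q^n + 1 - s_n`, `n ∈ F`; the stride readers of part 6. -/

/-- FF-DOOR (i).G, MATCHED FORM: a trace reader reading only lags in `[0, g] ∖ {m}` (`1 ≤ m ≤ g`, `q ≥ 1`) that
accepts ONE honest datum `h` of dimension `g` accepts INFINITELY MANY honest RH-false data of dimension `g` with the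
very same traces on `F`. [folklore] -/
theorem traceReader_offLag_fakes_infinite {Φ : Tower → Prop} {F : Set ℕ} {q : ℕ} (hq : 0 < q) {g m : ℕ}
    (hm1 : 1 ≤ m) (hmg : m ≤ g) (hF : ∀ n ∈ F, n ≤ g ∧ n ≠ m)
    (hloc : ∀ T T' : Tower, (∀ n ∈ F, T n 0 (Fin.last n) = T' n 0 (Fin.last n)) → Φ T → Φ T')
    {h : ℤ[X]} (hh : h.Monic) (hdeg : h.natDegree = 2 * g)
    (hFE : ∀ i j, i + j = 2 * g → (q : ℤ) ^ g * h.coeff j = (q : ℤ) ^ i * h.coeff i)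
    (hΦ : Φ (weilWindowTower (q : ℝ) h)) :
    {f : ℤ[X] | f.Monic ∧ f.natDegree = 2 * g ∧
      (∀ i j, i + j = 2 * g → (q : ℤ) ^ g * f.coeff j = (q : ℤ) ^ i * f.coeff i) ∧
      (¬ ∀ α ∈ frobRoots f, ‖α‖ = Real.sqrt q) ∧
      (∀ n ∈ F, weilWindowTower (q : ℝ) f n 0 (Fin.last n) = weilWindowTower (q : ℝ) h n 0 (Fin.last n)) ∧
      Φ (weilWindowTower (q : ℝ) f)}.Infinite := by
  have hq' : (0 : ℝ) < q := by exact_mod_cast hq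
  refine (sparseFibre_fakes_infinite hm1 hmg hh hdeg hFE).mono ?_
  rintro f ⟨hf, hdegf, hFEf, hps, hR⟩
  have htr : ∀ n ∈ F, weilWindowTower (q : ℝ) f n 0 (Fin.last n) = weilWindowTower (q : ℝ) h n 0 (Fin.last n) := by
    intro n hn
    obtain ⟨hng, hnm⟩ := hF n hn
    rcases Nat.eq_zero_or_pos n with rfl | hn1
    · exact corner_zero_eq_of_natDegree_eq _ hf hh (hdegf.trans hdeg.symm)
    · exact (corner_eq_iff_powerSum_eq hq' f h n).2 (hps n hn1 hng hnm)
  exact ⟨hf, hdegf, hFEf, hR, htr, hloc _ _ (fun n hn => (htr n hn).symm) hΦ⟩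

/-- FF-DOOR (i).G, the `∃`-form matching part 2's `finiteWindow_matched_by_rhFalse`: POSITION DOES NOT RESCUE A
SPARSE READER BELOW THE HANDOVER — whatever lags `F ⊆ [0, g] ∖ {m}` it reads, an honest datum it accepts is matched by
an honest RH-false datum of the same dimension it also accepts (`q ≥ 1`). [folklore] -/
theorem traceReader_offLag_matched_by_rhFalse {Φ : Tower → Prop} {F : Set ℕ} {q : ℕ} (hq : 0 < q) {g m : ℕ}
    (hm1 : 1 ≤ m) (hmg : m ≤ g) (hF : ∀ n ∈ F, n ≤ g ∧ n ≠ m)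
    (hloc : ∀ T T' : Tower, (∀ n ∈ F, T n 0 (Fin.last n) = T' n 0 (Fin.last n)) → Φ T → Φ T')
    {h : ℤ[X]} (hh : h.Monic) (hdeg : h.natDegree = 2 * g)
    (hFE : ∀ i j, i + j = 2 * g → (q : ℤ) ^ g * h.coeff j = (q : ℤ) ^ i * h.coeff i)
    (hΦ : Φ (weilWindowTower (q : ℝ) h)) :
    ∃ f : ℤ[X], f.Monic ∧ f.natDegree = 2 * g ∧
      (∀ i j, i + j = 2 * g → (q : ℤ) ^ g * f.coeff j = (q : ℤ) ^ i * f.coeff i) ∧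
      (¬ ∀ α ∈ frobRoots f, ‖α‖ = Real.sqrt q) ∧ Φ (weilWindowTower (q : ℝ) f) := by
  obtain ⟨f, hf, hdegf, hFEf, hR, -, hΦf⟩ :=
    (traceReader_offLag_fakes_infinite hq hm1 hmg hF hloc hh hdeg hFE hΦ).nonempty
  exact ⟨f, hf, hdegf, hFEf, hR, hΦf⟩

/-! ## 5. The exact threshold below the handover -/

/-- The power sums `s_1, …, s_g` PIN an honest datum of dimension `g` (`q ≥ 1`): Newton (`s ↦ e`), Vieta, and the
FE reflecting the lower coefficients (part 5b `eq_of_fe_of_coeff_eq_upper`).  Trace form of ffmirror-2's Handover.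
[folklore] -/
theorem eq_of_powerSum_eq_upto {q : ℕ} (hq : 0 < q) {h h' : ℤ[X]} {g : ℕ} (hh : h.Monic) (hh' : h'.Monic)
    (hdeg : h.natDegree = 2 * g) (hdeg' : h'.natDegree = 2 * g)
    (hFE : ∀ i j, i + j = 2 * g → (q : ℤ) ^ g * h.coeff j = (q : ℤ) ^ i * h.coeff i)
    (hFE' : ∀ i j, i + j = 2 * g → (q : ℤ) ^ g * h'.coeff j = (q : ℤ) ^ i * h'.coeff i)
    (hs : ∀ j, 1 ≤ j → j ≤ g → powerSum (frobRoots h) j = powerSum (frobRoots h') j) : h = h' := by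
  have he := esymm_eq_of_powerSum_eq hs
  refine eq_of_fe_of_coeff_eq_upper hq hdeg hdeg' hFE hFE' fun i hgi hi2g => ?_
  have hk : 2 * g - i ≤ g := by omega
  have e1 := cast_coeff_sub_eq_esymm hh (k := 2 * g - i) (by rw [hdeg]; omega)
  have e2 := cast_coeff_sub_eq_esymm hh' (k := 2 * g - i) (by rw [hdeg']; omega)
  rw [hdeg, show 2 * g - (2 * g - i) = i by omega] at e1
  rw [hdeg', show 2 * g - (2 * g - i) = i by omega] at e2
  rw [he _ hk] at e1
  exact Int.cast_injective (α := ℂ) (e1.trans e2.symm)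

/-- ABOVE THE THRESHOLD: the traces `K(1), …, K(g)` support a reader DECIDING RH at dimension `g` (`q ≥ 1`) — the
trace form of ffmirror-2's `exists_windowReader_of_predicate`: "some RH-true honest datum of dimension `g` has these
traces". [folklore] -/
theorem exists_traceReader_deciding {q : ℕ} (hq : 0 < q) (g : ℕ) :
    ∃ Φ : Tower → Prop,
      (∀ T T' : Tower, (∀ n ∈ Set.Icc 1 g, T n 0 (Fin.last n) = T' n 0 (Fin.last n)) → Φ T → Φ T') ∧
      ∀ h : ℤ[X], h.Monic → h.natDegree = 2 * g →
        (∀ i j, i + j = 2 * g → (q : ℤ) ^ g * h.coeff j = (q : ℤ) ^ i * h.coeff i) →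
        (Φ (weilWindowTower (q : ℝ) h) ↔ ∀ α ∈ frobRoots h, ‖α‖ = Real.sqrt q) := by
  have hq' : (0 : ℝ) < q := by exact_mod_cast hq
  refine ⟨fun T => ∃ f : ℤ[X], f.Monic ∧ f.natDegree = 2 * g ∧
      (∀ i j, i + j = 2 * g → (q : ℤ) ^ g * f.coeff j = (q : ℤ) ^ i * f.coeff i) ∧
      (∀ α ∈ frobRoots f, ‖α‖ = Real.sqrt q) ∧
      ∀ n ∈ Set.Icc 1 g, T n 0 (Fin.last n) = weilWindowTower (q : ℝ) f n 0 (Fin.last n), ?_, ?_⟩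
  · rintro T T' hTT' ⟨f, hf, hdegf, hFEf, hRf, htr⟩
    exact ⟨f, hf, hdegf, hFEf, hRf, fun n hn => (hTT' n hn).symm.trans (htr n hn)⟩
  · intro h hh hdeg hFE
    constructor
    · rintro ⟨f, hf, hdegf, hFEf, hRf, htr⟩
      have hs : ∀ j, 1 ≤ j → j ≤ g → powerSum (frobRoots h) j = powerSum (frobRoots f) j :=
        fun j hj1 hjg => (corner_eq_iff_powerSum_eq hq' h f j).1 (htr j ⟨hj1, hjg⟩)
      rw [eq_of_powerSum_eq_upto hq hh hf hdeg hdegf hFE hFEf hs]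
      exact hRf
    · intro hR
      exact ⟨h, hh, hdeg, hFE, hR, fun n _ => rfl⟩

/-- FF-DOOR (i).G, EXACT THRESHOLD BELOW THE HANDOVER.  For `q ≥ 1`, `g ≥ 1` and a set `F` of lags `≤ g`: there is
an `F`-trace-local reader deciding RH on the honest data of dimension `g` IF AND ONLY IF `F ⊇ {1, …, g}`.  No proper
subset of the first `g` traces (point counts) certifies RH at dimension `g` — whatever its position — and the full
set does, by pinning the datum. [folklore] -/
theorem traceReader_decides_iff {q : ℕ} (hq : 0 < q) {g : ℕ} (hg : 1 ≤ g) {F : Set ℕ} (hF : ∀ n ∈ F, n ≤ g) :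
    (∃ Φ : Tower → Prop,
      (∀ T T' : Tower, (∀ n ∈ F, T n 0 (Fin.last n) = T' n 0 (Fin.last n)) → Φ T → Φ T') ∧
      ∀ h : ℤ[X], h.Monic → h.natDegree = 2 * g →
        (∀ i j, i + j = 2 * g → (q : ℤ) ^ g * h.coeff j = (q : ℤ) ^ i * h.coeff i) →
        (Φ (weilWindowTower (q : ℝ) h) ↔ ∀ α ∈ frobRoots h, ‖α‖ = Real.sqrt q)) ↔
    ∀ m, 1 ≤ m → m ≤ g → m ∈ F := by
  constructor
  · rintro ⟨Φ, hloc, hdec⟩ m hm1 hmg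
    by_contra hmF
    have hF' : ∀ n ∈ F, n ≤ g ∧ n ≠ m := fun n hn => ⟨hF n hn, fun e => hmF (e ▸ hn)⟩
    obtain ⟨hmon, hdeg, hFE⟩ := fe_X_pow_add_C q hg
    have hΦ : Φ (weilWindowTower (q : ℝ) (X ^ (2 * g) + C ((q : ℤ) ^ g))) :=
      (hdec _ hmon hdeg hFE).2 (ffRH_X_pow_add_C q hg)
    obtain ⟨f, hf, hdegf, hFEf, hR, hΦf⟩ :=
      traceReader_offLag_matched_by_rhFalse hq hm1 hmg hF' hloc hmon hdeg hFE hΦ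
    exact hR ((hdec f hf hdegf hFEf).1 hΦf)
  · intro hfull
    obtain ⟨Φ, hloc, hdec⟩ := exists_traceReader_deciding hq g
    exact ⟨Φ, fun T T' hTT' => hloc T T' fun n hn => hTT' n (hfull n hn.1 hn.2), hdec⟩

/-- COUNT FORM: fewer than `g` lags from `[0, g]` never decide RH at dimension `g` (`q, g ≥ 1`). [folklore] -/
theorem traceReader_not_decides_of_card_lt {q : ℕ} (hq : 0 < q) {g : ℕ} (hg : 1 ≤ g) {F : Finset ℕ}
    (hF : ∀ n ∈ F, n ≤ g) (hcard : (F.filter (fun n => 1 ≤ n)).card < g) :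
    ¬ ∃ Φ : Tower → Prop,
      (∀ T T' : Tower, (∀ n ∈ (F : Set ℕ), T n 0 (Fin.last n) = T' n 0 (Fin.last n)) → Φ T → Φ T') ∧
      ∀ h : ℤ[X], h.Monic → h.natDegree = 2 * g →
        (∀ i j, i + j = 2 * g → (q : ℤ) ^ g * h.coeff j = (q : ℤ) ^ i * h.coeff i) →
        (Φ (weilWindowTower (q : ℝ) h) ↔ ∀ α ∈ frobRoots h, ‖α‖ = Real.sqrt q) := by
  rw [traceReader_decides_iff hq hg (F := (F : Set ℕ)) (fun n hn => hF n hn)]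
  intro hfull
  have hsub : Finset.Icc 1 g ⊆ F.filter (fun n => 1 ≤ n) := by
    intro m hm
    rw [Finset.mem_Icc] at hm
    exact Finset.mem_filter.2 ⟨hfull m hm.1 hm.2, hm.1⟩
  have := Finset.card_le_card hsub
  rw [Nat.card_Icc] at this
  omega

end Summit.RiemannHypothesis.RiemannHypothesis.Theorems.MotivicDoor.FunctionField

end
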